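import Literature.AlgebraicGeometry.ShimuraVarieties.UnitaryBallAutomorphicForms
import Literature.Geometry.ComplexHyperbolic.UnitBallIsotropyBlock
import HarnessLib

/-!
# The weight of holomorphic one-forms on `𝔹²` at the origin is `𝔭₋ = 𝔭₊^∨` (Borel–Wallach VI 4.8; Holzapfel 1998 §4.1)

Topic `AlgebraicGeometry/ShimuraVarieties`; namespace `Literature.AlgebraicGeometry.ShimuraVarieties.BallForms`.
For the cotangent cocycle `(g, z) ↦ (Jac g z)ᵀ` of `UnitaryBallAutomorphicForms` and its isotropy representation
`weightOf x₀ : Representation ℂ (stabilizer U21 x₀) (Fin 2 → ℂ)` (`AutomorphyFactorForms`, `k ↦ (Jac k⁻¹ x₀)ᵀ`), through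
the identification `stabilizerEquivK21 : U(2) × U(1) ≃* Stab(x₀)` of `UnitBallIsotropyBlock`:

* **`weightOf_cotangent_blockK : weightOf x₀ (diag(A,d)) c = pMinus (A,d) c = d • Ā c`** and, for an arbitrary
  stabiliser element, `weightOf_cotangent_apply : weightOf x₀ u c = pMinus (stabilizerEquivK21.symm u) c` — the
  classical weight `τ₁ = weightOf x₀` of one-forms IS `τ = 𝔭₋` of `U21KTypes`; `diag(1,−1)` acts by `−1`
  (`weightOf_cotangent_blockK_one_neg_one`), so **`eq_zero_of_forall_weightOf_cotangent_eq`: `τ₁` has no non-zero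
  `Stab(x₀)`-invariants** (the rigidity hypothesis `hτ` of the harmonic `K_∞`-type at the pin);
* its contragredient in dot-product coordinates (`dotProductEquiv : (Fin 2 → ℂ) ≃ₗ Module.Dual ℂ (Fin 2 → ℂ)`):
  **`weightOf_cotangent_dual_blockK : (weightOf x₀).dual (diag(A,d)) ⟨b, ·⟩ = ⟨pPlus (A,d) b, ·⟩ = ⟨d̄ • A b, ·⟩`** —
  `τ₁^∨ = 𝔭₊`, the tangent representation (`dotProduct_pMinus_pPlus`).

## References

* A. Borel, N. Wallach (2000), VI 4.8 (`τ₁` on `𝔭₊`, `τ₁^*`). [cite: BorelWallach2000, VI 4.8]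
* R.-P. Holzapfel, *Ball and Surface Arithmetics* (1998), §4.1.
* H. Jacobowitz (1990), Ch. 2 §1 Lemma 6(2) p. 41.

## Provenance

LEAN-IN-TREE rule (2026-08-18), pub-hodgecm model-construction sub-cell, seat mc-theta-2 gen 4: geometric half of the
archimedean `K`-type clause (W-K∞′) — the weight `τ₁ := weightOf x₀` and its dual `τ₁^∨` in coordinates.
-/

set_option autoImplicit false

noncomputable section

open Matrix MulAction
open scoped ComplexConjugate

namespace Literature.AlgebraicGeometry.ShimuraVarieties

namespace BallForms

open Literature.Geometry.ComplexHyperbolic.BallModel (U21 Ball Jac x₀ blockK blockU coe_blockK stabilizerEquivK21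
  Jac_blockU_inv_x₀_transpose_mulVec)
open Literature.NumberTheory.Automorphic.U21 (K21 matA sclD pPlus pMinus pMinus_apply dotProduct_pMinus_pPlus)
open Literature.NumberTheory.Automorphic.AutomorphyFactor

/-- **`τ₁ (diag(A,d)) = pMinus (A,d)`**: the weight of holomorphic one-forms at the origin, on the block-diagonal
stabiliser, is `c ↦ d • Ā c`. [cite: BorelWallach2000, VI 4.8] -/
theorem weightOf_cotangent_blockK (k : K21) (c : Fin 2 → ℂ) :
    isPullbackCocycle_cotangentCocycle.weightOf x₀ (blockK k) c = pMinus k c := by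
  rw [IsPullbackCocycle.weightOf_apply, coe_blockK, cotangentCocycle_apply, Jac_blockU_inv_x₀_transpose_mulVec]

/-- **`τ₁ = 𝔭₋` on the whole stabiliser** (through `stabilizerEquivK21`). [cite: BorelWallach2000, VI 4.8] -/
theorem weightOf_cotangent_apply (u : stabilizer U21 x₀) (c : Fin 2 → ℂ) :
    isPullbackCocycle_cotangentCocycle.weightOf x₀ u c = pMinus (stabilizerEquivK21.symm u) c := by
  conv_lhs => rw [← stabilizerEquivK21.apply_symm_apply u]
  exact weightOf_cotangent_blockK _ c

/-- `diag(1, −1) ∈ U(2) × U(1)` acts on one-forms at the origin by `−1`. [cite: BorelWallach2000, VI 4.8] -/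
theorem weightOf_cotangent_blockK_one_neg_one (c : Fin 2 → ℂ) :
    isPullbackCocycle_cotangentCocycle.weightOf x₀ (blockK (1, -1)) c = -c := by
  rw [weightOf_cotangent_blockK, pMinus_apply]
  have h1 : ((-1 : ↥(unitary ℂ)) : ℂ) = -1 := rfl
  simp [sclD, matA, h1]

/-- **`τ₁ = weightOf x₀` has no non-zero `Stab(x₀)`-invariant vector** (the element `diag(1,−1)` acts by `−1`) — the
hypothesis `hτ : ∀ w, (∀ u, τ₁ u w = w) → w = 0` of the rigidity of the harmonic `K_∞`-type at the pin.
[cite: BorelWallach2000, VI 4.8] -/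
theorem eq_zero_of_forall_weightOf_cotangent_eq (c : Fin 2 → ℂ)
    (h : ∀ u : stabilizer U21 x₀, isPullbackCocycle_cotangentCocycle.weightOf x₀ u c = c) : c = 0 := by
  have h1 := h (blockK (1, -1))
  rw [weightOf_cotangent_blockK_one_neg_one, neg_eq_iff_add_eq_zero, ← two_smul ℂ] at h1
  exact (smul_eq_zero.mp h1).resolve_left two_ne_zero

/-- `b ⬝ᵥ pMinus k⁻¹ c = pPlus k b ⬝ᵥ c` (the `K`-invariance of the pairing). [folklore] -/
theorem dotProduct_pMinus_inv (k : K21) (b c : Fin 2 → ℂ) : b ⬝ᵥ pMinus k⁻¹ c = pPlus k b ⬝ᵥ c := by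
  have hb : pPlus k⁻¹ (pPlus k b) = b := by
    rw [← Module.End.mul_apply, ← map_mul, inv_mul_cancel, map_one, Module.End.one_apply]
  rw [dotProduct_comm b, ← hb, dotProduct_pMinus_pPlus, hb, dotProduct_comm]

/-- `dotProductEquiv b c = b ⬝ᵥ c`. [folklore] -/
theorem dotProductEquiv_apply_apply' (b c : Fin 2 → ℂ) : dotProductEquiv ℂ (Fin 2) b c = b ⬝ᵥ c := rfl

/-- **`τ₁^∨ (diag(A,d)) = pPlus (A,d)` in dot-product coordinates**: the contragredient of the weight of one-forms is the
tangent representation `b ↦ d̄ • A b`. [cite: BorelWallach2000, VI 4.8] -/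
theorem weightOf_cotangent_dual_blockK (k : K21) (b : Fin 2 → ℂ) :
    (isPullbackCocycle_cotangentCocycle.weightOf x₀).dual (blockK k) (dotProductEquiv ℂ (Fin 2) b) =
      dotProductEquiv ℂ (Fin 2) (pPlus k b) := by
  apply LinearMap.ext
  intro c
  rw [Representation.dual_apply, Module.Dual.transpose_apply, LinearMap.comp_apply, dotProductEquiv_apply_apply',
    dotProductEquiv_apply_apply', ← map_inv, weightOf_cotangent_blockK, dotProduct_pMinus_inv]

/-- **`τ₁^∨ = 𝔭₊` on the whole stabiliser**, in dot-product coordinates. [cite: BorelWallach2000, VI 4.8] -/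
theorem weightOf_cotangent_dual_apply (u : stabilizer U21 x₀) (b : Fin 2 → ℂ) :
    (isPullbackCocycle_cotangentCocycle.weightOf x₀).dual u (dotProductEquiv ℂ (Fin 2) b) =
      dotProductEquiv ℂ (Fin 2) (pPlus (stabilizerEquivK21.symm u) b) := by
  conv_lhs => rw [← stabilizerEquivK21.apply_symm_apply u]
  exact weightOf_cotangent_dual_blockK _ b

end BallForms

end Literature.AlgebraicGeometry.ShimuraVarieties
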